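import Summits.ResolutionOfSingularities.ResolutionOfSingularities.Theses.Valuative
import Literature.AlgebraicGeometry.Resolution.ArithmeticalThreefolds

/-!
# Skeleton — line `pfaff-line-log-final-forms` for the crux `Valuative.LuAlphaPTorsor` (stmt-0641)

Lead prover's work file (copied from the planner's registered skeleton, stub signatures verbatim
from the ledger registration of 2026-08-16T00:00Z, composition re-written by the lead).

The line: work on the regular base `S = (A₁)_centre`; the exact form `d(t^p)` has a log-content
ideal w.r.t. a boundary `E ⊆ {u_1..u_d}`; (1) `stub_logPrincipalization` — after a local blow-up of
the base along `ν` that ideal is EXACTLY a monomial ideal `(∏_{i∈E} u_i^{M_i})` (hardest, ELU-type);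
(2) `stub_pthPowerModMonomial` — vanishing of all log-derivatives modulo `u^M` forces `a ≡ c^p mod u^M`;
(3) `stub_finalFormExits` — the final-form trichotomy (p-th power / regular exit / toroidal exit);
(4a) `stub_birationalExit` — `a = c^p` at the centre: `A₁[t]` has the same local ring; (4b)
`stub_monogenicExit` — `a − c^p = g^p·b` with `δ b` a unit gives a regular model (Stacks 07PG); (5) `stub_toroidalExit` — `a − c^p = u^M·B`, `B` unit, some
`p ∤ M_i`, gives a regular model (toric LU of a binomial hypersurface along `ν`).
`LuAlphaPTorsor_of` composes (1)–(5) into the crux BY NAME.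
-/

set_option linter.unusedVariables false
set_option linter.dupNamespace false

open IsLocalRing

namespace Summit.ResolutionOfSingularities.ResolutionOfSingularities.Cruxes.LuAlphaPTorsor.PfaffLine

/-- Stub 1 (HARDEST; lead): log-principalization of the content ideal of `d(t^p)` along `ν` on a
regular local blow-up of the base. -/
theorem stub_logPrincipalization :
    ∀ p : ℕ, p.Prime → ∀ (k K : Type) [Field k] [CharP k p] [Field K] [Algebra k K] (O : ValuationSubring K) (A₀ : Subalgebra k K) (h₀ : A₀.toSubring ≤ O.toSubring) (t : K), A₀.FG → ∀ (htp : t ^ p ∈ A₀), IsFractionRing (Algebra.adjoin k (insert t (A₀ : Set K))) K → IsRegularLocalRing (Localization.AtPrime (Ideal.comap (Subring.inclusion h₀) (IsLocalRing.maximalIdeal O))) → (∀ c : Localization.AtPrime (Ideal.comap (Subring.inclusion h₀) (IsLocalRing.maximalIdeal O)), algebraMap A₀.toSubring (Localization.AtPrime (Ideal.comap (Subring.inclusion h₀) (IsLocalRing.maximalIdeal O))) ⟨t ^ p, htp⟩ ≠ c ^ p) → ∃ (A₁ : Subalgebra k K) (h₁ : A₁.toSubring ≤ O.toSubring) (hle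 : A₀ ≤ A₁), A₁.FG ∧ IsRegularLocalRing (Localization.AtPrime (Ideal.comap (Subring.inclusion h₁) (IsLocalRing.maximalIdeal O))) ∧ ∃ (d : ℕ) (u : Fin d → Localization.AtPrime (Ideal.comap (Subring.inclusion h₁) (IsLocalRing.maximalIdeal O))) (E : Finset (Fin d)) (M : Fin d → ℕ), Ideal.span (Set.range u) = IsLocalRing.maximalIdeal (Localization.AtPrime (Ideal.comap (Subring.inclusion h₁) (IsLocalRing.maximalIdeal O))) ∧ ringKrullDim (Localization.AtPrime (Ideal.comap (Subring.inclusion h₁) (IsLocalRing.maximalIdeal O))) = (d : WithBot ℕ∞) ∧ Ideal.span {b | ∃ δ : Derivation ℤ (Localization.AtPrime (Ideal.comap (Subring.inclusion h₁) (IsLocalRing.maximalIdeal O))) (Localization.AtPrime (Ideal.comap (Subring.inclusion h₁) (IsLocalRing.maximalIdeal O))), (∀ i ∈ E, δ (u i) ∈ Ideal.span {u i}) ∧ δ (algebraMap A₁.toSubring (Localization.AtPrime (Ideal.comap (Subring.inclusion h₁) (IsLocalRing.maximalIdeal O))) ⟨t ^ p, hle htp⟩) = b} = Ideal.span {E.prod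 fun i => u i ^ M i} := by
  sorry

/-- Stub 2: if every log-derivative of `a` lies in the monomial ideal `(u^M)`, then `a` is a
`p`-th power modulo `(u^M)`. -/
theorem stub_pthPowerModMonomial :
    ∀ p : ℕ, p.Prime → ∀ (k K : Type) [Field k] [CharP k p] [Field K] [Algebra k K] (O : ValuationSubring K) (A : Subalgebra k K) (h : A.toSubring ≤ O.toSubring), A.FG → IsRegularLocalRing (Localization.AtPrime (Ideal.comap (Subring.inclusion h) (IsLocalRing.maximalIdeal O))) → ∀ (a : Localization.AtPrime (Ideal.comap (Subring.inclusion h) (IsLocalRing.maximalIdeal O))) (d : ℕ) (u : Fin d → Localization.AtPrime (Ideal.comap (Subring.inclusion h) (IsLocalRing.maximalIdeal O))) (E : Finset (Fin d)) (M : Fin d → ℕ), Ideal.span (Set.range u) = IsLocalRing.maximalIdeal (Localization.AtPrime (Ideal.comap (Subring.inclusion h) (IsLocalRing.maximalIdeal O))) ∧ ringKrullDim (Localization.AtPrime (Ideal.comap (Subring.inclusion h) (IsLocalRing.maximalIdeal O))) = (d : WithBot ℕ∞) → Ideal.span {b | ∃ δ : Derivation ℤ (Localization.AtPrime (Ideal.comap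 (Subring.inclusion h) (IsLocalRing.maximalIdeal O))) (Localization.AtPrime (Ideal.comap (Subring.inclusion h) (IsLocalRing.maximalIdeal O))), (∀ i ∈ E, δ (u i) ∈ Ideal.span {u i}) ∧ δ (a) = b} ≤ Ideal.span {E.prod fun i => u i ^ M i} → ∃ c : Localization.AtPrime (Ideal.comap (Subring.inclusion h) (IsLocalRing.maximalIdeal O)), a - c ^ p ∈ Ideal.span {E.prod fun i => u i ^ M i} := by
  sorry

/-- Stub 3: the log final-form trichotomy — with content EXACTLY `(u^M)` and `a ≡ c^p mod u^M`,
either `a` is a `p`-th power, or a regular exit datum, or a toroidal exit datum exists. -/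
theorem stub_finalFormExits :
    ∀ p : ℕ, p.Prime → ∀ (k K : Type) [Field k] [CharP k p] [Field K] [Algebra k K] (O : ValuationSubring K) (A : Subalgebra k K) (h : A.toSubring ≤ O.toSubring), A.FG → IsRegularLocalRing (Localization.AtPrime (Ideal.comap (Subring.inclusion h) (IsLocalRing.maximalIdeal O))) → ∀ (a c : Localization.AtPrime (Ideal.comap (Subring.inclusion h) (IsLocalRing.maximalIdeal O))) (d : ℕ) (u : Fin d → Localization.AtPrime (Ideal.comap (Subring.inclusion h) (IsLocalRing.maximalIdeal O))) (E : Finset (Fin d)) (M : Fin d → ℕ), Ideal.span (Set.range u) = IsLocalRing.maximalIdeal (Localization.AtPrime (Ideal.comap (Subring.inclusion h) (IsLocalRing.maximalIdeal O))) ∧ ringKrullDim (Localization.AtPrime (Ideal.comap (Subring.inclusion h) (IsLocalRing.maximalIdeal O))) = (d : WithBot ℕ∞) → Ideal.span {b | ∃ δ : Derivation ℤ (Localization.AtPrime (Ideal.comap (Subring.inclusion h) (IsLocalRing.maximalIdeal O))) (Localization.AtPrime (Ideal.comap (Subring.inclusion h) (IsLocalRing.maximalIdeal O))), (∀ i ∈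 E, δ (u i) ∈ Ideal.span {u i}) ∧ δ (a) = b} = Ideal.span {E.prod fun i => u i ^ M i} → a - c ^ p ∈ Ideal.span {E.prod fun i => u i ^ M i} → ((∃ c : Localization.AtPrime (Ideal.comap (Subring.inclusion h) (IsLocalRing.maximalIdeal O)), a = c ^ p) ∨ ∃ (c g b : Localization.AtPrime (Ideal.comap (Subring.inclusion h) (IsLocalRing.maximalIdeal O))) (δ : Derivation ℤ (Localization.AtPrime (Ideal.comap (Subring.inclusion h) (IsLocalRing.maximalIdeal O))) (Localization.AtPrime (Ideal.comap (Subring.inclusion h) (IsLocalRing.maximalIdeal O)))), g ≠ 0 ∧ a - c ^ p = g ^ p * b ∧ IsUnit (δ b)) ∨ (∃ (c : Localization.AtPrime (Ideal.comap (Subring.inclusion h) (IsLocalRing.maximalIdeal O))) (d : ℕ) (u : Fin d → Localization.AtPrime (Ideal.comap (Subring.inclusion h) (IsLocalRing.maximalIdeal O))) (M : Fin d → ℕ) (B : Localization.AtPrime (Ideal.comap (Subring.inclusion h) (IsLocalRing.maximalIdeal O))), Ideal.span (Set.range u) = IsLocalRing.maximalIdeal (Localization.AtPrime (Ideal.comap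 (Subring.inclusion h) (IsLocalRing.maximalIdeal O))) ∧ ringKrullDim (Localization.AtPrime (Ideal.comap (Subring.inclusion h) (IsLocalRing.maximalIdeal O))) = (d : WithBot ℕ∞) ∧ IsUnit B ∧ (∃ i, ¬ p ∣ M i) ∧ a - c ^ p = (Finset.univ.prod fun i => u i ^ M i) * B) := by
  sorry

/-- Stub 4a: the birational exit — `t^p` is already a `p`-th power in the local ring of the base at
the centre (then `t ∈ (A₁)_centre ⊆ K` and `A := A₁[t]` has the same local ring at the centre). -/
theorem stub_birationalExit :
    ∀ p : ℕ, p.Prime → ∀ (k K : Type) [Field k] [CharP k p] [Field K] [Algebra k K] (O : ValuationSubring K) (A₁ : Subalgebra k K) (h₁ : A₁.toSubring ≤ O.toSubring) (t : K), A₁.FG → ∀ (htp : t ^ p ∈ A₁), IsFractionRing (Algebra.adjoin k (insert t (A₁ : Set K))) K → IsRegularLocalRing (Localization.AtPrime (Ideal.comap (Subring.inclusion h₁) (IsLocalRing.maximalIdeal O))) → (∃ c : Localization.AtPrime (Ideal.comap (Subring.inclusion h₁) (IsLocalRing.maximalIdeal O)), algebraMap A₁.toSubring (Localization.AtPrime (Ideal.comap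 (Subring.inclusion h₁) (IsLocalRing.maximalIdeal O))) ⟨t ^ p, htp⟩ = c ^ p) → ∃ (A : Subalgebra k K) (h : A.toSubring ≤ O.toSubring), A₁ ≤ A ∧ t ∈ A ∧ A.FG ∧ IsFractionRing A K ∧ IsRegularLocalRing (Localization.AtPrime (Ideal.comap (Subring.inclusion h) (IsLocalRing.maximalIdeal O))) := by
  sorry

/-- Stub 4b: the monogenic exit — `a − c^p = g^p·b` with some derivative of `b` a unit: adjoin
`t' = (t − c)/g` (`t'^p = b`); `R[T]/(T^p − b)` is regular by Stacks 07PG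
(`isRegularRing_adjoinRoot_X_pow_sub_C_of_derivation`, in tree). -/
theorem stub_monogenicExit :
    ∀ p : ℕ, p.Prime → ∀ (k K : Type) [Field k] [CharP k p] [Field K] [Algebra k K] (O : ValuationSubring K) (A₁ : Subalgebra k K) (h₁ : A₁.toSubring ≤ O.toSubring) (t : K), A₁.FG → ∀ (htp : t ^ p ∈ A₁), IsFractionRing (Algebra.adjoin k (insert t (A₁ : Set K))) K → IsRegularLocalRing (Localization.AtPrime (Ideal.comap (Subring.inclusion h₁) (IsLocalRing.maximalIdeal O))) → (∃ (c g b : Localization.AtPrime (Ideal.comap (Subring.inclusion h₁) (IsLocalRing.maximalIdeal O))) (δ : Derivation ℤ (Localization.AtPrime (Ideal.comap (Subring.inclusion h₁) (IsLocalRing.maximalIdeal O))) (Localization.AtPrime (Ideal.comap (Subring.inclusion h₁) (IsLocalRing.maximalIdeal O)))), g ≠ 0 ∧ algebraMap A₁.toSubring (Localization.AtPrime (Ideal.comap (Subring.inclusion h₁) (IsLocalRing.maximalIdeal O))) ⟨t ^ p, htp⟩ - c ^ p = g ^ p * b ∧ IsUnit (δ b)) → ∃ (A : Subalgebra k K) (h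 : A.toSubring ≤ O.toSubring), A₁ ≤ A ∧ t ∈ A ∧ A.FG ∧ IsFractionRing A K ∧ IsRegularLocalRing (Localization.AtPrime (Ideal.comap (Subring.inclusion h) (IsLocalRing.maximalIdeal O))) := by
  sorry

/-- Stub 5: the toroidal exit — `a − c^p = u^M·B` with `B` a unit and some exponent prime to `p`
gives a regular model along `ν` (toric local uniformization of a binomial hypersurface). -/
theorem stub_toroidalExit :
    ∀ p : ℕ, p.Prime → ∀ (k K : Type) [Field k] [CharP k p] [Field K] [Algebra k K] (O : ValuationSubring K) (A₁ : Subalgebra k K) (h₁ : A₁.toSubring ≤ O.toSubring) (t : K), A₁.FG → ∀ (htp : t ^ p ∈ A₁), IsFractionRing (Algebra.adjoin k (insert t (A₁ : Set K))) K → IsRegularLocalRing (Localization.AtPrime (Ideal.comap (Subring.inclusion h₁) (IsLocalRing.maximalIdeal O))) → (∃ (c : Localization.AtPrime (Ideal.comap (Subring.inclusion h₁) (IsLocalRing.maximalIdeal O))) (d : ℕ) (u : Fin d → Localization.AtPrime (Ideal.comap (Subring.inclusion h₁) (IsLocalRing.maximalIdeal O))) (M : Fin d → ℕ) (B : Localization.AtPrime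 (Ideal.comap (Subring.inclusion h₁) (IsLocalRing.maximalIdeal O))), Ideal.span (Set.range u) = IsLocalRing.maximalIdeal (Localization.AtPrime (Ideal.comap (Subring.inclusion h₁) (IsLocalRing.maximalIdeal O))) ∧ ringKrullDim (Localization.AtPrime (Ideal.comap (Subring.inclusion h₁) (IsLocalRing.maximalIdeal O))) = (d : WithBot ℕ∞) ∧ IsUnit B ∧ (∃ i, ¬ p ∣ M i) ∧ algebraMap A₁.toSubring (Localization.AtPrime (Ideal.comap (Subring.inclusion h₁) (IsLocalRing.maximalIdeal O))) ⟨t ^ p, htp⟩ - c ^ p = (Finset.univ.prod fun i => u i ^ M i) * B) → ∃ (A : Subalgebra k K) (h : A.toSubring ≤ O.toSubring), A₁ ≤ A ∧ t ∈ A ∧ A.FG ∧ IsFractionRing A K ∧ IsRegularLocalRing (Localization.AtPrime (Ideal.comap (Subring.inclusion h) (IsLocalRing.maximalIdeal O))) := by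
  sorry

/-! ## Composition -/

/-- `A₀[t] ≤ A₁[t]` when `A₀ ≤ A₁` (glue). -/
theorem adjoin_insert_mono {k K : Type} [Field k] [Field K] [Algebra k K]
    {A₀ A₁ : Subalgebra k K} (hle : A₀ ≤ A₁) (t : K) :
    Algebra.adjoin k (insert t (A₀ : Set K)) ≤ Algebra.adjoin k (insert t (A₁ : Set K)) :=
  Algebra.adjoin_mono (Set.insert_subset_insert hle)

/-- **The line closes the crux modulo its stubs**: `stub_logPrincipalization`,
`stub_pthPowerModMonomial`, `stub_finalFormExits`, `stub_birationalExit`, `stub_monogenicExit`,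
`stub_toroidalExit` together
give `Valuative.LuAlphaPTorsor` (by name). Case split on whether `t^p` is already a `p`-th power in
the local ring of the base at the centre (birational case → regular exit with `A₁ = A₀`);
otherwise principalize, extract the `p`-th power, and dispatch on the final-form trichotomy. -/
theorem LuAlphaPTorsor_of :
    Summit.ResolutionOfSingularities.ResolutionOfSingularities.Theses.Valuative.LuAlphaPTorsor := by
  intro p hp k K _ _ _ _ O A₀ h₀ t hfg htp hfr hreg
  by_cases hpow : ∃ c : Localization.AtPrime (Ideal.comap (Subring.inclusion h₀)
      (IsLocalRing.maximalIdeal O)), algebraMap A₀.toSubring (Localization.AtPrime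
        (Ideal.comap (Subring.inclusion h₀) (IsLocalRing.maximalIdeal O))) ⟨t ^ p, htp⟩ = c ^ p
  · exact stub_birationalExit p hp k K O A₀ h₀ t hfg htp hfr hreg hpow
  · push Not at hpow
    obtain ⟨A₁, h₁, hle, hA₁fg, hA₁reg, d, u, E, M, hspan, hdim, hcontent⟩ :=
      stub_logPrincipalization p hp k K O A₀ h₀ t hfg htp hfr hreg hpow
    have hfr₁ : IsFractionRing (Algebra.adjoin k (insert t (A₁ : Set K))) K :=
      Literature.AlgebraicGeometry.Resolution.isFractionRing_of_le (adjoin_insert_mono hle t) hfr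
    have htp₁ : t ^ p ∈ A₁ := hle htp
    obtain ⟨c, hc⟩ := stub_pthPowerModMonomial p hp k K O A₁ h₁ hA₁fg hA₁reg _ d u E M
      ⟨hspan, hdim⟩ hcontent.le
    rcases stub_finalFormExits p hp k K O A₁ h₁ hA₁fg hA₁reg _ c d u E M ⟨hspan, hdim⟩ hcontent hc
      with hPR | hT
    · rcases hPR with hP | hR
      · obtain ⟨A, h, hle₁, ht, hAfg, hAfr, hAreg⟩ :=
          stub_birationalExit p hp k K O A₁ h₁ t hA₁fg htp₁ hfr₁ hA₁reg hP
        exact ⟨A, h, hle.trans hle₁, ht, hAfg, hAfr, hAreg⟩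
      · obtain ⟨A, h, hle₁, ht, hAfg, hAfr, hAreg⟩ :=
          stub_monogenicExit p hp k K O A₁ h₁ t hA₁fg htp₁ hfr₁ hA₁reg hR
        exact ⟨A, h, hle.trans hle₁, ht, hAfg, hAfr, hAreg⟩
    · obtain ⟨A, h, hle₁, ht, hAfg, hAfr, hAreg⟩ :=
        stub_toroidalExit p hp k K O A₁ h₁ t hA₁fg htp₁ hfr₁ hA₁reg hT
      exact ⟨A, h, hle.trans hle₁, ht, hAfg, hAfr, hAreg⟩

end Summit.ResolutionOfSingularities.ResolutionOfSingularities.Cruxes.LuAlphaPTorsor.PfaffLine
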